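import Summits.Ventures.Crystal3D.Theorems.StickyWulffConstantNoReconstructionGainFracOrientation
import Summits.Ventures.Crystal3D.Theorems.StickyWulffConstantNoReconstructionGainExactBasalBilayer
import Summits.Ventures.Crystal3D.Theorems.StickyWulffConstantNoReconstructionGainExactCompatible
import Summits.Ventures.Crystal3D.Theorems.StickyWulffConstantNoReconstructionGainConfinedCertificateDefs
import Summits.Ventures.Crystal3D.Theorems.StickyWulffConstantNoReconstructionGainGrainFrameLocal
import HarnessLib

/-!
# Height-confined `(111)` films: reduction of «no criminal» to a windowed weighted-kissing bound
# (line `replication-exactness`, inside `stub_noCriminal`)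

HONEST FRAMING. Part of the venture `Summits/Ventures/Crystal3D` (cell `crystal3d-full`), helper `--supports` the
crux `NoReconstructionGain` (stmt-Ventures-19144, route `route-Ventures-StickyWulffConstant`), lead wulff-p1 g20.
A REDUCTION, not a resolution.  The pointwise "weighted kissing" method (a height profile `g`, every bond `q'—q`
charged `g(h_{q'} − h_q)/2` to `q`, every substrate plug charged `1`) is killed on UNCONFINED films by the certified
no-go `WKNoGo.weightedKissing_noGo_ten` (ten-point codes of vertical extent `≈ 1.55`; any eleven-ball cluster may
float above the face).  What survives is the CONFINED case: if every ball of a film over the close-packed layer `k`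
of `Λ₀` lies at height `≤ (k+1)√(2/3) + W`, then the full neighbour code of a ball at height `h` (directions to its
film partners AND to its substrate plugs) is a `60°`-code whose members sit either at height exactly
`a − √(2/3)` (plugs, top substrate layer; `a := (k+1)√(2/3) − h ≤ 0`) or in the window `[a, a + W]` (film partners,
which lie at height `≥ (k+1)√(2/3)` by `le_height_of_isFilmOn_basal`).  So:

* (`…ConfinedCertificateDefs`) `ConfinedCodeBound W g` — NAMED SHAPE: for every offset `a` and every finite
  `60°`-code `N` of unit vectors with each member at third coordinate `a − √(2/3)` or in `[a, a + W]`,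
  `Σ_{u ∈ N} g(u₂) ≤ 12` (nothing asserted; false at `W = 2` for every admissible antitone `g` — the WK no-go);
* `plug_apply_two_eq_basal` — over layer `k` every substrate plug of a film ball lies IN layer `k`;
* `not_isCriminal_basal_of_confinedCodeBound` — **the reduction**: for a profile `g` with `g z + g (−z) = 2` and
  `g = 2` on `z ≤ −√(2/3)` (plugs pay in full), `ConfinedCodeBound W g` implies that NO film over layer `k`
  (`k√(2/3) ≤ s < (k+1)√(2/3)`) confined below height `(k+1)√(2/3) + W` is a criminal (via the fractional
  orientation licence `not_isCriminal_of_fracOrientation` with `y q' q := g((q' − q)₂)/2`);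
* `not_isCriminal_basal_bilayer_of_confinedCodeBound` — the same read for films within the first TWO adsorbed
  layers (all balls at height `≤ (k+2)√(2/3) + 1/4`): window `W = √(2/3) + 1/4`.

The thin-film theorem `not_isCriminal_basal_of_low_offLattice` is the case `W = 1/4` proved outright; the numerics
of this generation (kit j330789, memo CONFINED-CERT-g20.md) locate the windows `W` for which a profile exists.
WHAT THIS IS NOT: `ConfinedCodeBound W g` is proved here for NO `W > 0`; other faces untouched; the crux and
rung F-C1 not moved.
-/

noncomputable section

namespace Summit.Ventures.Crystal3D.Theorems

open Summit.Ventures.Crystal3D Finset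
open Literature.MathematicalPhysics.StatisticalMechanics (fccStacking contactDeficiency barlowPos barlowPos_mem
  barlowPos_apply_two constHagg isHaggSeq_const le_dist_of_mem_barlowStacking_ideal)
open scoped InnerProductSpace

/-- The third coordinate is the `e₃`-height. -/
private theorem inner_e3' (v : EuclideanSpace ℝ (Fin 3)) :
    ⟪v, EuclideanSpace.single 2 (1 : ℝ)⟫_ℝ = v 2 := by
  rw [EuclideanSpace.inner_single_right]; simp


/-! ## Small tools -/

/-- A film ball lies at most `1` above (in `e₃`-height) any point at distance `1` from it. -/
private theorem sub_apply_two_le_one_of_dist {q p : EuclideanSpace ℝ (Fin 3)} (h : dist q p = 1) :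
    q 2 - p 2 ≤ 1 := by
  have h1 := real_inner_le_norm (q - p) (EuclideanSpace.single 2 (1 : ℝ))
  rw [inner_e3', PiLp.sub_apply, PiLp.norm_single, norm_one, mul_one, ← dist_eq_norm, h] at h1
  exact h1

/-- Over the close-packed layer `k` (`k√(2/3) ≤ s < (k+1)√(2/3)`), every substrate plug of a film ball lies in
layer `k` exactly: its height is `k√(2/3)`. -/
theorem plug_apply_two_eq_basal (k : ℤ) {s : ℝ} (hs : (k : ℝ) * Real.sqrt (2 / 3) ≤ s)
    (hs' : s < ((k : ℝ) + 1) * Real.sqrt (2 / 3)) {Q : Finset (EuclideanSpace ℝ (Fin 3))}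
    (hQ : IsFilmOn (EuclideanSpace.single 2 (1 : ℝ)) s Q) {q : EuclideanSpace ℝ (Fin 3)} (hq : q ∈ Q)
    {p : EuclideanSpace ℝ (Fin 3)} (hp : p ∈ plugSet (EuclideanSpace.single 2 (1 : ℝ)) s q) :
    p 2 = (k : ℝ) * Real.sqrt (2 / 3) := by
  obtain ⟨⟨hpΛ, hps⟩, hpd⟩ := hp
  obtain ⟨k', i, j, rfl⟩ := hpΛ
  rw [inner_e3', barlowPos_apply_two] at hps
  rw [barlowPos_apply_two]
  have hpos : 0 < Real.sqrt (2 / 3) := Real.sqrt_pos.2 (by norm_num)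
  have h23 : Real.sqrt (2 / 3) ^ 2 = 2 / 3 := Real.sq_sqrt (by norm_num)
  have hbig : 1 < 2 * Real.sqrt (2 / 3) := by nlinarith [h23, hpos]
  -- `k' ≤ k` from the cut, `k ≤ k'` from the unit distance to a ball at height `≥ (k+1)√(2/3)`
  have hle : k' ≤ k := by
    have hlt : (k' : ℝ) * Real.sqrt (2 / 3) < ((k : ℝ) + 1) * Real.sqrt (2 / 3) := hps.trans_lt hs'
    have h1 : (k' : ℝ) < k + 1 := lt_of_mul_lt_mul_right hlt hpos.le
    exact Int.lt_add_one_iff.1 (by exact_mod_cast h1)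
  have hge : k ≤ k' := by
    have hq2 := le_height_of_isFilmOn_basal k hs hQ hq
    have hqp := sub_apply_two_le_one_of_dist hpd
    rw [barlowPos_apply_two] at hqp
    have h1 : ((k : ℝ) + 1) * Real.sqrt (2 / 3) - 1 ≤ (k' : ℝ) * Real.sqrt (2 / 3) := by linarith
    have h2 : ((k : ℝ) - 1) * Real.sqrt (2 / 3) < (k' : ℝ) * Real.sqrt (2 / 3) := by nlinarith
    have h3 : (k : ℝ) - 1 < k' := lt_of_mul_lt_mul_right h2 hpos.le
    have h4 : k - 1 < k' := by exact_mod_cast h3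
    omega
  rw [le_antisymm hle hge]

/-! ## The reduction -/

/-- **Height-confined `(111)` films: «no criminal» from the windowed weighted-kissing bound.**  Let `g` be a
height profile with `g z + g (−z) = 2` and `g z = 2` for `z ≤ −√(2/3)` (substrate plugs are paid in full by the
film ball), and suppose `ConfinedCodeBound W g`.  Then over the close-packed layer `k` of `Λ₀`
(`k√(2/3) ≤ s < (k+1)√(2/3)`, normal `e₃`) no film all of whose balls lie at height `≤ (k+1)√(2/3) + W` is a
criminal.  Proof: charge every film bond `q'—q` the amount `g((q' − q)₂)/2` to `q`; at a ball `q` of height `h`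
the directions to its film partners and to its plugs form a `60°`-code with plug members at third coordinate
`(k+1)√(2/3) − h − √(2/3)` and partner members in `[(k+1)√(2/3) − h, (k+1)√(2/3) − h + W]`, so the bound gives
`Σ_{q'} g((q'−q)₂) + 2·plug(q) ≤ 12`, i.e. the fractional orientation certificate of
`not_isCriminal_of_fracOrientation`. -/
theorem not_isCriminal_basal_of_confinedCodeBound (k : ℤ) {s : ℝ} (hs : (k : ℝ) * Real.sqrt (2 / 3) ≤ s)
    (hs' : s < ((k : ℝ) + 1) * Real.sqrt (2 / 3)) {W : ℝ} {g : ℝ → ℝ} (hsym : ∀ z, g z + g (-z) = 2)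
    (hplug : ∀ z, z ≤ -Real.sqrt (2 / 3) → g z = 2) (hW : ConfinedCodeBound W g)
    {Q : Finset (EuclideanSpace ℝ (Fin 3))}
    (hconf : ∀ q ∈ Q, q 2 ≤ ((k : ℝ) + 1) * Real.sqrt (2 / 3) + W) :
    ¬ IsCriminal (EuclideanSpace.single 2 (1 : ℝ)) s Q := by
  classical
  intro hcrim
  have hQ : IsFilmOn (EuclideanSpace.single 2 (1 : ℝ)) s Q := hcrim.1
  set ν : EuclideanSpace ℝ (Fin 3) := EuclideanSpace.single 2 (1 : ℝ) with hν
  set c : ℝ := Real.sqrt (2 / 3) with hc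
  have h23 : Real.sqrt (2 / 3) ^ 2 = 2 / 3 * (1 : ℝ) ^ 2 := by rw [Real.sq_sqrt (by norm_num)]; norm_num
  refine not_isCriminal_of_fracOrientation (ν := ν) (s := s) (fun x q => g ((x - q) 2) / 2)
    (fun q _ q' _ _ => ?_) (fun q hq => ?_) hcrim
  · -- antisymmetric splitting of every bond
    have : (q - q') 2 = -((q' - q) 2) := by simp [PiLp.sub_apply]
    rw [this]; linarith [hsym ((q' - q) 2)]
  · -- the neighbour code of `q`
    set P : Finset (EuclideanSpace ℝ (Fin 3)) := (plugSet_finite ν s q).toFinset with hP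
    set F : Finset (EuclideanSpace ℝ (Fin 3)) := Q.filter (fun q' => dist q q' = 1) with hF
    have hPmem : ∀ p, p ∈ P ↔ p ∈ plugSet ν s q := fun p => by rw [hP, Set.Finite.mem_toFinset]
    have hFmem : ∀ x, x ∈ F ↔ x ∈ Q ∧ dist q x = 1 := fun x => by rw [hF, Finset.mem_filter]
    -- distances: all of `F ∪ P` at distance `1` from `q`, pairwise `≥ 1` apart
    have hdist1 : ∀ x ∈ F ∪ P, dist q x = 1 := by
      intro x hx
      rcases Finset.mem_union.1 hx with hx | hx
      · exact ((hFmem x).1 hx).2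
      · exact ((hPmem x).1 hx).2
    have hsep : ∀ x ∈ F ∪ P, ∀ x' ∈ F ∪ P, x ≠ x' → 1 ≤ dist x x' := by
      intro x hx x' hx' hne
      rcases Finset.mem_union.1 hx with hx | hx <;> rcases Finset.mem_union.1 hx' with hx' | hx'
      · exact hQ.1 x ((hFmem x).1 hx).1 x' ((hFmem x').1 hx').1 hne
      · exact hQ.2 x ((hFmem x).1 hx).1 x' ((hPmem x').1 hx').1
      · rw [dist_comm]; exact hQ.2 x' ((hFmem x').1 hx').1 x ((hPmem x).1 hx).1
      · exact le_dist_of_mem_barlowStacking_ideal isHaggSeq_const one_pos h23 ((hPmem x).1 hx).1.1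
          ((hPmem x').1 hx').1.1 hne
    have hdisj : Disjoint F P := by
      rw [Finset.disjoint_left]
      intro x hxF hxP
      have h := hQ.2 x ((hFmem x).1 hxF).1 x ((hPmem x).1 hxP).1
      rw [dist_self] at h
      exact absurd h (by norm_num)
    -- the code
    set N : Finset (EuclideanSpace ℝ (Fin 3)) := (F ∪ P).image (fun x => x - q) with hN
    have hinj : Set.InjOn (fun x => x - q) ↑(F ∪ P) := fun x _ x' _ h => sub_left_injective h
    have hN1 : ∀ u ∈ N, ‖u‖ = 1 := by
      intro u hu
      obtain ⟨x, hx, rfl⟩ := Finset.mem_image.1 hu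
      rw [← dist_eq_norm, dist_comm]; exact hdist1 x hx
    have hN2 : ∀ u ∈ N, ∀ v ∈ N, u ≠ v → ⟪u, v⟫_ℝ ≤ 1 / 2 := by
      intro u hu v hv huv
      obtain ⟨x, hx, rfl⟩ := Finset.mem_image.1 hu
      obtain ⟨x', hx', rfl⟩ := Finset.mem_image.1 hv
      have hne : x ≠ x' := fun h => huv (by rw [h])
      exact real_inner_sub_le_half_of_dist (hdist1 x hx) (hdist1 x' hx') (hsep x hx x' hx' hne)
    -- the window, with offset `a := (k+1)c − q₂`
    set a : ℝ := ((k : ℝ) + 1) * c - q 2 with ha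
    have hN3 : ∀ u ∈ N, u 2 = a - Real.sqrt (2 / 3) ∨ (a ≤ u 2 ∧ u 2 ≤ a + W) := by
      intro u hu
      obtain ⟨x, hx, rfl⟩ := Finset.mem_image.1 hu
      rw [PiLp.sub_apply]
      rcases Finset.mem_union.1 hx with hx | hx
      · right
        have hxQ := ((hFmem x).1 hx).1
        have hlo := le_height_of_isFilmOn_basal k hs hQ hxQ
        have hhi := hconf x hxQ
        constructor <;> [rw [ha]; rw [ha]] <;> linarith
      · left
        rw [plug_apply_two_eq_basal k hs hs' hQ hq ((hPmem x).1 hx), ha, hc]; ring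
    have hbound := hW a N hN1 hN2 hN3
    -- unfold the sum over the code
    rw [hN, Finset.sum_image hinj, Finset.sum_union hdisj] at hbound
    have hPsum : ∑ x ∈ P, g ((x - q) 2) = 2 * (P.card : ℝ) := by
      rw [Finset.sum_congr rfl fun x hx => ?_, Finset.sum_const, nsmul_eq_mul, mul_comm]
      rw [PiLp.sub_apply, plug_apply_two_eq_basal k hs hs' hQ hq ((hPmem x).1 hx)]
      apply hplug
      have := le_height_of_isFilmOn_basal k hs hQ hq
      linarith
    have hcard : ((plugSet ν s q).ncard : ℝ) = P.card := by
      rw [hP, Set.ncard_eq_toFinset_card _ (plugSet_finite ν s q)]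
    rw [hPsum] at hbound
    rw [hcard, ← Finset.sum_div]
    have : ∑ x ∈ F, g ((x - q) 2) = ∑ i ∈ F, g ((i - q) 2) := rfl
    linarith

/-- **Films within the first two adsorbed layers.**  The reduction read at the window `W = √(2/3) + 1/4`: if the
windowed bound holds for that width (and an admissible `g`), then over the close-packed layer `k` of `Λ₀` no film
all of whose balls lie at height `≤ (k+2)√(2/3) + 1/4` — hollow, bridge and atop positions of the first AND of the
second adsorbed layer, and everything in between — is a criminal.  (The first-layer case, height
`≤ (k+1)√(2/3) + 1/4`, is `not_isCriminal_basal_of_low_offLattice`, proved outright.) -/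
theorem not_isCriminal_basal_bilayer_of_confinedCodeBound (k : ℤ) {s : ℝ}
    (hs : (k : ℝ) * Real.sqrt (2 / 3) ≤ s) (hs' : s < ((k : ℝ) + 1) * Real.sqrt (2 / 3)) {g : ℝ → ℝ}
    (hsym : ∀ z, g z + g (-z) = 2) (hplug : ∀ z, z ≤ -Real.sqrt (2 / 3) → g z = 2)
    (hW : ConfinedCodeBound (Real.sqrt (2 / 3) + 1 / 4) g) {Q : Finset (EuclideanSpace ℝ (Fin 3))}
    (hconf : ∀ q ∈ Q, q 2 ≤ ((k : ℝ) + 2) * Real.sqrt (2 / 3) + 1 / 4) :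
    ¬ IsCriminal (EuclideanSpace.single 2 (1 : ℝ)) s Q :=
  not_isCriminal_basal_of_confinedCodeBound k hs hs' hsym hplug hW fun q hq => by
    have := hconf q hq; linarith

end Summit.Ventures.Crystal3D.Theorems

end
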